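import Summits.BirchSwinnertonDyer.BirchSwinnertonDyer.Theorems.PrintCf2SplitBadTwoCMShaModule
import Summits.BirchSwinnertonDyer.BirchSwinnertonDyer.Theorems.PrintCf2SplitBadTwoCMPrimaryRationalSwap
import Summits.BirchSwinnertonDyer.BirchSwinnertonDyer.Theorems.PrintCf2SplitBadTwoCMPrimaryModule
import Literature.NumberTheory.EllipticCurves.IsogenyHasCMBaseChangeProofs
import Literature.NumberTheory.EllipticCurves.IsogenyGroundFieldExtension
import Literature.NumberTheory.EllipticCurves.HeegnerPoints
import Literature.FieldTheory.Galois.SolvableCompositum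
import Literature.NumberTheory.EllipticCurves.AnticyclotomicCompactSelmer
import HarnessLib

/-!
# Crux `PrintCf2.SplitBadTwoRankOneOfFacts` (item stmt-BirchSwinnertonDyer-20368), road α over the CM field:
# a lift of `Gal(K/ℚ)` CONJUGATING the complex multiplication (`τ π τ⁻¹ = π̄`) acts on `Ш(E_K/K)`, hence
# `#Ш(E_K/K)[2^∞] = (#Ш[𝔭^∞])²` and `ord₂ #Ш(E_K/K)[2^∞] = 2 · ord₂ #Ш[𝔭^∞] = 2 · ord₂ #Ш[𝔭̄^∞]`

Cell `bsd-print-cf2`, width seat `bsd-line-cf2-p1-w8` g0 (planner WIDTH BRICK MENU 16:11:50Z, brick **B6**, first half — companion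
of `PrintCf2SplitBadTwoCMShaModule`); `--supports stmt-BirchSwinnertonDyer-20368` (helper). HONEST FRAMING: nothing here closes a
crux or a stub; BSD is not proved by any of this; no summit statement is proved by this seat. No definition is introduced.
beyond-print theorem: no (Galois bookkeeping on `Ш`).

THE POINT. `…CMShaModule.card_sha_two_primary_eq_sq_of_lift` needs a lift `τ` of some `σ ∈ Aut(K/ℚ)` with `φ (τ Q) = τ Q − τ (φ Q)`
on `E(K̄)` (`τ φ τ⁻¹ = φ̄ = 1 − φ`). For `E = W/ℚ` and `K/ℚ` GALOIS such a lift always exists, with NO model- or `j`-specific input: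
transport the endo-isogeny `φ` of `E_K` back to `E(ℚ̄)` along the tree's `ℚ̄ ≃ₐ[ℚ] K̄` (`absClosureEquiv`, `geomPointsExtend`;
algebraicity by `isAlgebraicOn_conj_symm_of_algEquiv`), pick -w2 g7's `φ`-conjugating `σ₀ ∈ Γ_ℚ` (`CMPrimes.exists_conj_cmEndo_eq_one_sub`:
`φ ∉ End_ℚ(E)` since `End_ℚ(E) = ℤ`, plus the dichotomy `σφσ⁻¹ ∈ {φ, φ̄}`), move it to `K̄` as `τ₀ = ι σ₀ ι⁻¹`, and restrict it to
`K` by normality (`AlgEquiv.restrictNormal`) — `τ₀` lifts `σ' := τ₀|_K ∈ Aut(K/ℚ)` (`exists_conjugating_lift`). Consequences: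

* **`card_sha_two_primary_eq_sq`, `padicValNat_card_sha_two_primary_eq_two_mul`** — for `K/ℚ` Galois with all infinite places
  complex, an endo-isogeny `φ` of `E_K` over `K` with `φ(φP) = φP − 2P`, ANY `2`-adic root `r` of `X² − X + 2`, and the eigen-subgroups
  `C = Ш[𝔭^∞]`, `C' = Ш[𝔭̄^∞]` of `M = Ш(E_K/K)[2^∞]` (where `Ш(φ)` acts as `r`, resp. `1 − r`; -w2 g7's integer-approximation
  currency read on `H¹(K, E)`): `#C = #C'`, `#M = (#C)² = (#C')²`, `ord₂ #M = 2·ord₂ #C = 2·ord₂ #C'` (`Nat.card`; no finiteness).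
* **`exists_cmIsogeny_card_sha_two_primary_eq_sq`** — the crux's setting BY NAME: `W/ℚ` elliptic with `j = −3375`, `K ∋ θ`, `θ² = −7`,
  `K/ℚ` Galois and totally complex (`K₀ = ℚ(√−7)`: `…_of_isImaginaryQuadratic`): the complex multiplication `π = [(1+√−7)/2]`
  (-w2 g7's `exists_endRing_cmEndo_two`) IS such a `φ` (`…CMShaModule.exists_isogeny_apply_eq_cmEndo`), so the count holds for the
  tree's `Ш((W⁄K)/K)[2^∞]` — the bookkeeping `ord₂ #Ш(W/K₀)[2^∞] = 2·ord₂ #Ш(W/K₀)[𝔭^∞]` of STUB-PLAN `stub_heegnerIndexLowerAtTwo` T3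
  and of road α's S3b (Rubin's `#Ш(E/K)[𝔭*^∞]`-currency vs Miller's `#Ш[2^∞]`).

References: B. H. Gross, LMS LNS 153 (1991) §5 (5.1); K. Rubin, LNM 1716 (1999) §2 and Cor. 10.3 shape in Invent. Math. 107 (1992);
[SilvermanATAEC1994] II §2 Thm. 2.2(b); J.-P. Serre, *Galois Cohomology*, I.§2.4.
-/

noncomputable section

open scoped Classical

set_option linter.dupNamespace false
set_option autoImplicit false

namespace Summit.BirchSwinnertonDyer.BirchSwinnertonDyer.Theorems.PrintCf2.CMPrimes

open WeierstrassCurve Literature.NumberTheory.EllipticCurves Field NumberField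
open Summit.BirchSwinnertonDyer.BirchSwinnertonDyer.Theorems

/-! ## §1 The conjugating lift: transport of -w2 g7's `σ₀ ∈ Γ_ℚ` to `K̄` and restriction to `K` -/

section Lift

variable (W : WeierstrassCurve ℚ) [W.IsElliptic] (K : Type) [Field K] [NumberField K]

/-- **Transport to `E(ℚ̄)`.** For an endo-isogeny `φ` of `E_K` (`E = W/ℚ`) with `φ(φP) = φP − 2P` and the tree's `ι : ℚ̄ ≃ₐ[ℚ] K̄`,
`e = geomPointsExtend`: the conjugate `π₀ = e⁻¹ φ e` is a geometric endomorphism of `E` over `ℚ` (`isAlgebraicOn_conj_symm_of_algEquiv`)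
with `π₀² = π₀ − 2`, and some `σ₀ ∈ Γ_ℚ` conjugates it to `1 − π₀` (-w2 g7's `exists_conj_cmEndo_eq_one_sub`): pointwise
`π₀ (σ₀ • P) = σ₀ • P − σ₀ • π₀ P`. [cite: SilvermanATAEC1994, II §2 Thm. 2.2(b) with Remark II.2.2.2] -/
theorem exists_ratConj_of_cmIsogeny (φ : Isogeny (W.baseChange K) (W.baseChange K)) (hrel : ∀ P, φ (φ P) = φ P - 2 • P) :
    ∃ σ₀ : absoluteGaloisGroup ℚ, ∀ P : W.geomPoints,
      (W.geomPointsExtend K (Literature.NumberTheory.EllipticCurves.absClosureEquiv ℚ K)).symm (φ (W.geomPointsExtend K (Literature.NumberTheory.EllipticCurves.absClosureEquiv ℚ K) (σ₀ • P))) =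
        σ₀ • P - σ₀ • (W.geomPointsExtend K (Literature.NumberTheory.EllipticCurves.absClosureEquiv ℚ K)).symm (φ (W.geomPointsExtend K (Literature.NumberTheory.EllipticCurves.absClosureEquiv ℚ K) P)) := by
  set ι := Literature.NumberTheory.EllipticCurves.absClosureEquiv ℚ K with hι
  set e := W.geomPointsExtend K ι with he
  set π₀ : AddMonoid.End W.geomPoints :=
    (e.symm.toAddMonoidHom.comp φ.toAddMonoidHom).comp e.toAddMonoidHom with hπ₀_def
  have hπ₀_apply : ∀ P, π₀ P = e.symm (φ (e P)) := fun _ ↦ rfl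
  have halg : IsAlgebraicOn W W π₀ := isAlgebraicOn_conj_symm_of_algEquiv ι e (fun _ ↦ rfl) φ.isAlgebraic
  have hmem : π₀ ∈ W.geomEndRing := Subring.subset_closure halg
  have hrel₀ : π₀ * π₀ = π₀ - 2 := by
    ext P
    have e2 : (π₀ - 2 : AddMonoid.End W.geomPoints) P = π₀ P - 2 • P := by
      change (π₀ : W.geomPoints →+ W.geomPoints) P -
        ((2 : AddMonoid.End W.geomPoints) : W.geomPoints →+ W.geomPoints) P = _
      simp
    refine Eq.trans ?_ e2.symm
    change π₀ (π₀ P) = _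
    rw [hπ₀_apply, hπ₀_apply, e.apply_symm_apply, hrel, map_sub, map_nsmul, e.symm_apply_apply]
  obtain ⟨σ₀, hσ₀⟩ := exists_conj_cmEndo_eq_one_sub W hmem hrel₀
  refine ⟨σ₀, fun P ↦ ?_⟩
  have h := congrArg (fun f : AddMonoid.End W.geomPoints ↦ f (σ₀ • P)) hσ₀
  simp only [toAddMonoidEnd_mul_mul_toAddMonoidEnd_inv_apply, inv_smul_smul] at h
  -- `h : σ₀ • π₀ P = (1 - π₀) (σ₀ • P)`
  have e1 : (1 - π₀ : AddMonoid.End W.geomPoints) (σ₀ • P) = σ₀ • P - π₀ (σ₀ • P) := by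
    change ((1 : AddMonoid.End W.geomPoints) : W.geomPoints →+ W.geomPoints) (σ₀ • P) -
      (π₀ : W.geomPoints →+ W.geomPoints) (σ₀ • P) = _
    simp
  rw [e1] at h
  -- `π₀ (σ₀ • P) = σ₀ • P - σ₀ • π₀ P`
  rw [← hπ₀_apply, ← hπ₀_apply, h, sub_sub_cancel]

/-- **The conjugating lift exists** (`E = W/ℚ`, `K/ℚ` a GALOIS number field, `φ` an endo-isogeny of `E_K` over `K` with
`φ(φP) = φP − 2P`): there are `σ' ∈ Aut(K/ℚ)` and a lift `τ` of `σ'` to `K̄` with `φ (τ Q) = τ Q − τ (φ Q)` for all `Q ∈ E(K̄)`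
(`τ φ τ⁻¹ = 1 − φ = φ̄`). Construction: `τ = ι σ₀ ι⁻¹` for -w2 g7's conjugating `σ₀ ∈ Γ_ℚ` (`exists_ratConj_of_cmIsogeny`) and the
tree's `ι : ℚ̄ ≃ₐ[ℚ] K̄`; `σ' = τ|_K` by normality (`AlgEquiv.restrictNormal`). For `K ∋ √−7` this `σ'` moves `√−7` (it does not commute
with `π`, -w2 g7's `cmEndo_mem_endRing_of_sq_eq_neg_seven`), i.e. it is «complex conjugation» on `ℚ(√−7)`; that identification is not
needed here and not claimed. [cite: GrossLMS1991, §5 (5.1)] [cite: SilvermanATAEC1994, II §2 Thm. 2.2(b)] -/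
theorem exists_conjugating_lift [Normal ℚ K] (φ : Isogeny (W.baseChange K) (W.baseChange K))
    (hrel : ∀ P, φ (φ P) = φ P - 2 • P) :
    ∃ (σ' : K ≃ₐ[ℚ] K) (τ : AlgebraicClosure K ≃+* AlgebraicClosure K) (hτ : IsLiftOfAut σ' τ),
      ∀ Q, φ (hτ.pointsMap W Q) = hτ.pointsMap W Q - hτ.pointsMap W (φ Q) := by
  obtain ⟨σ₀, hσ₀⟩ := exists_ratConj_of_cmIsogeny W K φ hrel
  set ι := Literature.NumberTheory.EllipticCurves.absClosureEquiv ℚ K with hι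
  set e := W.geomPointsExtend K ι with he
  -- `τ = ι σ₀ ι⁻¹` (the tree's `absGaloisTransportRat`), `σ' = τ|_K` by normality
  have hτ : IsLiftOfAut ((absGaloisTransportRat K σ₀).restrictNormal K) (absGaloisTransportRat K σ₀).toRingEquiv :=
    fun x ↦ absGaloisTransportRat_algebraMap σ₀ x
  -- coordinates: `τ (ι z) = ι (σ₀ • z)`
  have hcoord : ∀ z : AlgebraicClosure ℚ, absGaloisTransportRat K σ₀ (ι z) = ι (σ₀ • z) := fun z ↦ by
    rw [hι]
    change absGaloisTransport (K := ℚ) (L := K) σ₀ (Literature.NumberTheory.EllipticCurves.absClosureEquiv ℚ K z) = _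
    rw [absGaloisTransport_apply, AlgEquiv.symm_apply_apply]
  -- points: `τ (e P) = e (σ₀ • P)`
  have hτe : ∀ P : W.geomPoints, hτ.pointsMap W (e P) = e (σ₀ • P) := by
    intro P
    change (W.baseChange (AlgebraicClosure ℚ)).toAffine.Point at P
    rcases P with _ | ⟨x, y, h⟩
    · rfl
    · change Affine.Point.map (W' := W) hτ.algEquiv.toAlgHom (Affine.Point.map (W' := W) ι.toAlgHom (.some x y h)) =
        Affine.Point.map (W' := W) ι.toAlgHom
          (Affine.Point.map (W' := W) (absoluteGaloisGroup.toAlgEquiv ℚ σ₀).toAlgHom (.some x y h))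
      rw [Affine.Point.map_some, Affine.Point.map_some, Affine.Point.map_some, Affine.Point.map_some]
      exact Affine.Point.some_eq_some_of_eq (hcoord x) (hcoord y)
  refine ⟨(absGaloisTransportRat K σ₀).restrictNormal K, (absGaloisTransportRat K σ₀).toRingEquiv, hτ, fun Q ↦ ?_⟩
  obtain ⟨P, rfl⟩ := e.surjective Q
  have hP' : φ (e (σ₀ • P)) = e (σ₀ • P) - e (σ₀ • e.symm (φ (e P))) := by
    have := congrArg e (hσ₀ P)
    rw [e.apply_symm_apply, map_sub] at this
    exact this
  rw [hτe, hP', ← hτe, ← hτe, e.apply_symm_apply]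

end Lift

/-! ## §2 The swap count on `Ш(E_K/K)[2^∞]` for `K/ℚ` Galois -/

section Count

variable (W : WeierstrassCurve ℚ) [W.IsElliptic] {K : Type} [Field K] [NumberField K]

/-- **`#Ш(E_K/K)[2^∞] = (#Ш[𝔭^∞])² = (#Ш[𝔭̄^∞])²` and `#Ш[𝔭^∞] = #Ш[𝔭̄^∞]`** for `E = W/ℚ` elliptic, `K/ℚ` a Galois number field all of
whose infinite places are complex, `φ` an endo-isogeny of `E_K` over `K` with `φ(φP) = φP − 2P` (complex multiplication by `(1+√−7)/2`),
`r ∈ ℤ₂` any root of `X² − X + 2`, and `C = Ш[𝔭^∞]`, `C' = Ш[𝔭̄^∞] ≤ M = Ш(E_K/K)[2^∞]` the subgroups where `Ш(φ)` acts as `r`,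
resp. `1 − r` (read on `H¹(K, E)`). `Nat.card`, no finiteness of `Ш` assumed. (`…CMShaModule.card_sha_two_primary_eq_sq_of_lift` with
the lift of `exists_conjugating_lift`.) [cite: GrossLMS1991, §5 (5.1)] [cite: SilvermanATAEC1994, II §2 Thm. 2.2(b) and App. A §3] -/
theorem card_sha_two_primary_eq_sq [Normal ℚ K] (hK : ∀ w : InfinitePlace K, w.IsComplex)
    (φ : Isogeny (W.baseChange K) (W.baseChange K)) (hrel : ∀ P, φ (φ P) = φ P - 2 • P)
    {r : ℤ_[2]} (hr : r * r = r - 2)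
    {C C' : AddSubgroup (AddCommGroup.primaryComponent (W.baseChange K).sha 2)}
    (hC : ∀ x, x ∈ C ↔ ∀ (k : ℕ) (N : ℤ), 2 ^ k • x = 0 →
      ((N : ℤ_[2]) - r) ∈ (Ideal.span {(2 : ℤ_[2]) ^ k} : Ideal ℤ_[2]) →
        galH1Map φ.toAddMonoidHom φ.equivariant
            (((x : AddCommGroup.primaryComponent (W.baseChange K).sha 2) : (W.baseChange K).sha) : (W.baseChange K).galH1) =
          N • (((x : AddCommGroup.primaryComponent (W.baseChange K).sha 2) : (W.baseChange K).sha) : (W.baseChange K).galH1))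
    (hC' : ∀ x, x ∈ C' ↔ ∀ (k : ℕ) (N : ℤ), 2 ^ k • x = 0 →
      ((N : ℤ_[2]) - (1 - r)) ∈ (Ideal.span {(2 : ℤ_[2]) ^ k} : Ideal ℤ_[2]) →
        galH1Map φ.toAddMonoidHom φ.equivariant
            (((x : AddCommGroup.primaryComponent (W.baseChange K).sha 2) : (W.baseChange K).sha) : (W.baseChange K).galH1) =
          N • (((x : AddCommGroup.primaryComponent (W.baseChange K).sha 2) : (W.baseChange K).sha) : (W.baseChange K).galH1)) :
    Nat.card C = Nat.card C' ∧
      Nat.card (AddCommGroup.primaryComponent (W.baseChange K).sha 2) = Nat.card C ^ 2 ∧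
      Nat.card (AddCommGroup.primaryComponent (W.baseChange K).sha 2) = Nat.card C' ^ 2 := by
  obtain ⟨σ', τ, hτ, hanti⟩ := exists_conjugating_lift W K φ hrel
  exact card_sha_two_primary_eq_sq_of_lift W hK hτ φ hrel hanti hr hC hC'

/-- **`ord₂ #Ш(E_K/K)[2^∞] = 2 · ord₂ #Ш[𝔭^∞] = 2 · ord₂ #Ш[𝔭̄^∞]`** in the setting of `card_sha_two_primary_eq_sq`.
[cite: GrossLMS1991, §5 (5.1)] -/
theorem padicValNat_card_sha_two_primary_eq_two_mul [Normal ℚ K] (hK : ∀ w : InfinitePlace K, w.IsComplex)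
    (φ : Isogeny (W.baseChange K) (W.baseChange K)) (hrel : ∀ P, φ (φ P) = φ P - 2 • P)
    {r : ℤ_[2]} (hr : r * r = r - 2)
    {C C' : AddSubgroup (AddCommGroup.primaryComponent (W.baseChange K).sha 2)}
    (hC : ∀ x, x ∈ C ↔ ∀ (k : ℕ) (N : ℤ), 2 ^ k • x = 0 →
      ((N : ℤ_[2]) - r) ∈ (Ideal.span {(2 : ℤ_[2]) ^ k} : Ideal ℤ_[2]) →
        galH1Map φ.toAddMonoidHom φ.equivariant
            (((x : AddCommGroup.primaryComponent (W.baseChange K).sha 2) : (W.baseChange K).sha) : (W.baseChange K).galH1) =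
          N • (((x : AddCommGroup.primaryComponent (W.baseChange K).sha 2) : (W.baseChange K).sha) : (W.baseChange K).galH1))
    (hC' : ∀ x, x ∈ C' ↔ ∀ (k : ℕ) (N : ℤ), 2 ^ k • x = 0 →
      ((N : ℤ_[2]) - (1 - r)) ∈ (Ideal.span {(2 : ℤ_[2]) ^ k} : Ideal ℤ_[2]) →
        galH1Map φ.toAddMonoidHom φ.equivariant
            (((x : AddCommGroup.primaryComponent (W.baseChange K).sha 2) : (W.baseChange K).sha) : (W.baseChange K).galH1) =
          N • (((x : AddCommGroup.primaryComponent (W.baseChange K).sha 2) : (W.baseChange K).sha) : (W.baseChange K).galH1)) :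
    padicValNat 2 (Nat.card (AddCommGroup.primaryComponent (W.baseChange K).sha 2)) = 2 * padicValNat 2 (Nat.card C) ∧
      padicValNat 2 (Nat.card (AddCommGroup.primaryComponent (W.baseChange K).sha 2)) = 2 * padicValNat 2 (Nat.card C') := by
  obtain ⟨-, h1, h2⟩ := card_sha_two_primary_eq_sq W hK φ hrel hr hC hC'
  exact ⟨by rw [h1, padicValNat.pow], by rw [h2, padicValNat.pow]⟩

end Count

/-! ## §3 The crux's setting: `j = −3375`, `K ∋ √−7` Galois and totally complex (`K₀ = ℚ(√−7)`) -/

section CM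

variable (W : WeierstrassCurve ℚ) [W.IsElliptic]

/-- **THE Ш-SIDE CM BOOKKEEPING OVER `K ∋ √−7`.** `W/ℚ` elliptic with `j = −3375`, `K` a number field, Galois over `ℚ`, all infinite
places complex, `θ ∈ K` with `θ² = −7`. Then there is an endo-isogeny `φ` of `W_K` over `K` — the complex multiplication
`[(1 + √−7)/2]` (-w2 g7's `exists_endRing_cmEndo_two`, packaged by `exists_isogeny_apply_eq_cmEndo`) — with `φ(φP) = φP − 2P` and
`#ker φ = 2`, such that for EVERY `2`-adic root `r` of `X² − X + 2` and the eigen-subgroups `C = Ш[𝔭^∞]` (`Ш(φ)` acts as `r`),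
`C' = Ш[𝔭̄^∞]` (`Ш(φ)` acts as `1 − r`) of `M = Ш(W_K/K)[2^∞]`: `#C = #C'`, `#M = (#C)² = (#C')²` and
`ord₂ #M = 2·ord₂ #C = 2·ord₂ #C'` (`Nat.card`; no finiteness of `Ш` assumed).
[cite: GrossLMS1991, §5 (5.1)] [cite: SilvermanATAEC1994, II §1 Prop. 1.1, II §2 Thm. 2.2(b), App. A §3 (row D = -7)] -/
theorem exists_cmIsogeny_card_sha_two_primary_eq_sq (hj : W.j = -3375) (K : Type) [Field K] [NumberField K] [Normal ℚ K]
    (hK : ∀ w : InfinitePlace K, w.IsComplex) {θ : K} (hθ : θ ^ 2 = -7) :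
    ∃ φ : Isogeny (W.baseChange K) (W.baseChange K),
      (∀ P, φ (φ P) = φ P - 2 • P) ∧ Nat.card φ.toAddMonoidHom.ker = 2 ∧
      ∀ {r : ℤ_[2]}, r * r = r - 2 →
      ∀ {C C' : AddSubgroup (AddCommGroup.primaryComponent (W.baseChange K).sha 2)},
        (∀ x, x ∈ C ↔ ∀ (k : ℕ) (N : ℤ), 2 ^ k • x = 0 →
          ((N : ℤ_[2]) - r) ∈ (Ideal.span {(2 : ℤ_[2]) ^ k} : Ideal ℤ_[2]) →
            galH1Map φ.toAddMonoidHom φ.equivariant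
                (((x : AddCommGroup.primaryComponent (W.baseChange K).sha 2) : (W.baseChange K).sha) : (W.baseChange K).galH1) =
              N • (((x : AddCommGroup.primaryComponent (W.baseChange K).sha 2) : (W.baseChange K).sha) :
                (W.baseChange K).galH1)) →
        (∀ x, x ∈ C' ↔ ∀ (k : ℕ) (N : ℤ), 2 ^ k • x = 0 →
          ((N : ℤ_[2]) - (1 - r)) ∈ (Ideal.span {(2 : ℤ_[2]) ^ k} : Ideal ℤ_[2]) →
            galH1Map φ.toAddMonoidHom φ.equivariant
                (((x : AddCommGroup.primaryComponent (W.baseChange K).sha 2) : (W.baseChange K).sha) : (W.baseChange K).galH1) =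
              N • (((x : AddCommGroup.primaryComponent (W.baseChange K).sha 2) : (W.baseChange K).sha) :
                (W.baseChange K).galH1)) →
        Nat.card C = Nat.card C' ∧
          Nat.card (AddCommGroup.primaryComponent (W.baseChange K).sha 2) = Nat.card C ^ 2 ∧
          Nat.card (AddCommGroup.primaryComponent (W.baseChange K).sha 2) = Nat.card C' ^ 2 ∧
          padicValNat 2 (Nat.card (AddCommGroup.primaryComponent (W.baseChange K).sha 2)) = 2 * padicValNat 2 (Nat.card C) ∧
          padicValNat 2 (Nat.card (AddCommGroup.primaryComponent (W.baseChange K).sha 2)) = 2 * padicValNat 2 (Nat.card C') := by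
  haveI : (W.baseChange K).IsElliptic := inferInstanceAs ((W.map (algebraMap ℚ K)).IsElliptic)
  obtain ⟨π, hrel, hker, -⟩ := exists_endRing_cmEndo_two W hj K hθ
  have hπG : ∀ (g : absoluteGaloisGroup K) (P : (W.baseChange K).geomPoints),
      (π : AddMonoid.End (W.baseChange K).geomPoints) (g • P) = g • (π : AddMonoid.End (W.baseChange K).geomPoints) P :=
    fun g P ↦ ((W.baseChange K).mem_equivariantSubring_iff _).1 (Subring.mem_inf.1 π.2).2 g P
  obtain ⟨φ, hφπ, hφrel⟩ := exists_isogeny_apply_eq_cmEndo (W.baseChange K) (Subring.mem_inf.1 π.2).1 hπG hrel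
  refine ⟨φ, hφrel, ?_, fun hr C C' hC hC' ↦ ?_⟩
  · rw [← hker]
    exact Nat.card_congr (Equiv.subtypeEquivRight fun Q ↦ by
      change φ Q = 0 ↔ (π : AddMonoid.End (W.baseChange K).geomPoints) Q = 0
      rw [hφπ])
  · obtain ⟨h0, h1, h2⟩ := card_sha_two_primary_eq_sq W hK φ hφrel hr hC hC'
    exact ⟨h0, h1, h2, by rw [h1, padicValNat.pow], by rw [h2, padicValNat.pow]⟩

/-- **The same over an IMAGINARY QUADRATIC `K ∋ √−7`, i.e. `K₀ = ℚ(√−7)`** (`IsImaginaryQuadratic K`: degree `2` — hence Galois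
(`isGalois_of_finrank_eq_two`) — and totally complex). [cite: GrossLMS1991, §5 (5.1)]
[cite: SilvermanATAEC1994, II §1 Prop. 1.1, II §2 Thm. 2.2(b), App. A §3 (row D = -7)] -/
theorem exists_cmIsogeny_card_sha_two_primary_eq_sq_of_isImaginaryQuadratic (hj : W.j = -3375)
    (K : Type) [Field K] [NumberField K] (hKq : IsImaginaryQuadratic K) {θ : K} (hθ : θ ^ 2 = -7) :
    ∃ φ : Isogeny (W.baseChange K) (W.baseChange K),
      (∀ P, φ (φ P) = φ P - 2 • P) ∧ Nat.card φ.toAddMonoidHom.ker = 2 ∧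
      ∀ {r : ℤ_[2]}, r * r = r - 2 →
      ∀ {C C' : AddSubgroup (AddCommGroup.primaryComponent (W.baseChange K).sha 2)},
        (∀ x, x ∈ C ↔ ∀ (k : ℕ) (N : ℤ), 2 ^ k • x = 0 →
          ((N : ℤ_[2]) - r) ∈ (Ideal.span {(2 : ℤ_[2]) ^ k} : Ideal ℤ_[2]) →
            galH1Map φ.toAddMonoidHom φ.equivariant
                (((x : AddCommGroup.primaryComponent (W.baseChange K).sha 2) : (W.baseChange K).sha) : (W.baseChange K).galH1) =
              N • (((x : AddCommGroup.primaryComponent (W.baseChange K).sha 2) : (W.baseChange K).sha) :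
                (W.baseChange K).galH1)) →
        (∀ x, x ∈ C' ↔ ∀ (k : ℕ) (N : ℤ), 2 ^ k • x = 0 →
          ((N : ℤ_[2]) - (1 - r)) ∈ (Ideal.span {(2 : ℤ_[2]) ^ k} : Ideal ℤ_[2]) →
            galH1Map φ.toAddMonoidHom φ.equivariant
                (((x : AddCommGroup.primaryComponent (W.baseChange K).sha 2) : (W.baseChange K).sha) : (W.baseChange K).galH1) =
              N • (((x : AddCommGroup.primaryComponent (W.baseChange K).sha 2) : (W.baseChange K).sha) :
                (W.baseChange K).galH1)) →
        Nat.card C = Nat.card C' ∧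
          Nat.card (AddCommGroup.primaryComponent (W.baseChange K).sha 2) = Nat.card C ^ 2 ∧
          Nat.card (AddCommGroup.primaryComponent (W.baseChange K).sha 2) = Nat.card C' ^ 2 ∧
          padicValNat 2 (Nat.card (AddCommGroup.primaryComponent (W.baseChange K).sha 2)) = 2 * padicValNat 2 (Nat.card C) ∧
          padicValNat 2 (Nat.card (AddCommGroup.primaryComponent (W.baseChange K).sha 2)) = 2 * padicValNat 2 (Nat.card C') := by
  haveI : IsGalois ℚ K := Literature.FieldTheory.Galois.isGalois_of_finrank_eq_two (F := ℚ) hKq.1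
  haveI : IsTotallyComplex K := hKq.2
  exact exists_cmIsogeny_card_sha_two_primary_eq_sq W hj K (fun w ↦ IsTotallyComplex.isComplex w) hθ

end CM

end Summit.BirchSwinnertonDyer.BirchSwinnertonDyer.Theorems.PrintCf2.CMPrimes

end
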